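import Summits.ValiantsHypothesis.ValiantsHypothesis.Theorems.SymPencilPerFourCrossSixForms

/-!
# Route `SymPencil` — the cross space `V× = row 0 ⊕ k E₁₀ ⊕ k E₂₀` at size `27`, FRONT half:
# the affine lever along `a = E₀₁ + E₀₂ + E₀₃` pins the lever space to `{x₃' = 0}` and makes its
# kernel rows `C(a)D⁻¹`-invariant (`--supports` stmt-ValiantsHypothesis-5674 `SdcSuperquadratic`;
# cell `(10,6,6)` of the size-`27` kernel-package table, rung currency only, nothing here bears
# on `VP ≠ VNP`)

Setting: the base-point package of a symmetric representation of `per_4`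
(`SymPencilPerFourBasePointPackage`) with `|ι'| ≤ 26`, `dim (im bL) = 10` and kernel space EXACTLY
the cross space `V× = {x : x_{ij} = 0 unless i = 0 or (i,j) ∈ {(1,0),(2,0)}}` — the one
`6`-dimensional singular subspace that carries a joint family of six squares
(`SymPencilPerFourSixDimJointSix`, `Cruxes/SdcSuperquadratic/TORIC-SIX.md` §X), so that the
`V`-side of the cell `(10,6,6)` cannot exclude it.  The pencil does.  With `a = E₀₁ + E₀₂ + E₀₃`
(`per_4` is affine along the row `0`), `N = CL(a) D⁻¹`, `T_t = 1 + t N = (D + t CL a) D⁻¹`: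

* `per_shift_cross` / `eval_cross_pencil`: the two `per_4` computations — translating by
  `p E₁₀ + q E₂₀` changes the cubic `F_a = per_4(· + a) - per_4` by `p C₁ + q C₂`,
  `C₁(x) = x₂'ᵀ A x₃'`, `C₂(x) = x₁'ᵀ A x₃'`, `A = 𝟙𝟙ᵀ - 1`; and on
  `X₀ = {rows 1,2 on columns 1..3} ⊕ k E₃₀`: `per_4 (t a + s x) = s³ t · x₃₀ · x₁'ᵀ A x₂'`.
* `rows_three_eq_zero_of_isotropic` (the size-`27` count): a subspace of the complement
  coordinates on which `C₁, C₂` vanish has dimension `≤ 7`, with equality only inside `{x₃' = 0}`.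
* `cross_front` (MAIN): for `t ≠ 0` the lever space `im bL ∩ T_t (im bL)` (dimension `≥ 7` by
  `SymPencilAffineKernelLever.four_mul_finrank_le_of_affine`) lies in — hence equals —
  `B₁₂ := bL(X₀)` (lever + count); comparing `t = 1, 2` gives `K := {y ∈ im bL : N y ∈ im bL} = B₁₂`
  and the INVARIANCE `N B₁₂ ⊆ B₁₂`, stated coordinate-wise.

The back half (`SymPencilPerFourCrossSix`) transports `N` to `X₀`, reads the base-point identity
at `t a` with `det (D + t CL a) = det D` and ends in `SymPencilPerFourCrossSixEndgame`.  No
definitions, no named facts. [folklore]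
-/

noncomputable section

-- single-conjunct layout: Sub = Summit, duplicated namespace component intended
set_option linter.dupNamespace false

namespace Summit.ValiantsHypothesis.ValiantsHypothesis.Theorems.SymPencilPerFourCrossSixFront

open Matrix MvPolynomial Module
open Literature.Computability.AlgebraicComplexity
open Summit.ValiantsHypothesis.ValiantsHypothesis.Theorems.SymPencilLagrangianKernel
open Summit.ValiantsHypothesis.ValiantsHypothesis.Theorems.SymPencilAffineKernelLever
open Summit.ValiantsHypothesis.ValiantsHypothesis.Theorems.SymPencilSdcPerFourTwentySeven
open Summit.ValiantsHypothesis.ValiantsHypothesis.Theorems.SymPencilPerFourCrossSixForms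
open Literature.Computability.AlgebraicComplexity.AlperBogartVelasco

universe u

variable {k : Type u} [Field k] [CharZero k] {ι' : Type*} [Fintype ι'] [DecidableEq ι']

/-- **The front theorem for the cross space.**  In the base-point package with `|ι'| ≤ 26`,
`dim (im bL) ≥ 10` and kernel space exactly `V× = row 0 ⊕ k E₁₀ ⊕ k E₂₀`, the kernel rows of the
space `X₀ = {rows 1,2 on columns 1..3} ⊕ k E₃₀` are invariant under `C(a) D⁻¹`,
`a = E₀₁ + E₀₂ + E₀₃`. [folklore] -/
theorem cross_front {D : Matrix ι' ι' k} (hD : IsUnit D.det) (hDs : Dᵀ = D)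
    (bL : (Fin 4 × Fin 4 → k) →ₗ[k] (ι' → k)) (CL : (Fin 4 × Fin 4 → k) →ₗ[k] Matrix ι' ι' k)
    (hCs : ∀ z, (CL z)ᵀ = CL z) {κ : k} (hκ : κ ≠ 0)
    (hii : ∀ z, bL z ⬝ᵥ (D⁻¹ * CL z * D⁻¹) *ᵥ bL z = 0)
    (hN : ∀ v, bL v = 0 → IsUnit (D + CL v).det ∧ ∀ (z : Fin 4 × Fin 4 → k) (s : k),
      κ * MvPolynomial.eval (v + s • z) (perPoly (Fin 4) k) =
        (Matrix.fromBlocks ((s * 0) • (1 : Matrix Unit Unit k))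
          (Matrix.replicateRow Unit (s • bL z)) (Matrix.replicateCol Unit (s • bL z))
          (D + CL v + s • CL z)).det)
    (hker : ∀ x : Fin 4 × Fin 4 → k,
      bL x = 0 ↔ ∀ z : Fin 4 × Fin 4, ¬ (z.1 = 0 ∨ z = (1, 0) ∨ z = (2, 0)) → x z = 0)
    (h10 : 10 ≤ finrank k (LinearMap.range bL)) (hcard : Fintype.card ι' ≤ 26)
    (ω : k) (r : Fin 2 × Fin 3 → k) :
    ∃ (ω' : k) (r' : Fin 2 × Fin 3 → k),
      CL (fun z : Fin 4 × Fin 4 =>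
          (Matrix.of ![![0, 1, 1, 1], ![0, 0, 0, 0], ![0, 0, 0, 0], ![0, 0, 0, 0]]) z.1 z.2) *ᵥ
        (D⁻¹ *ᵥ bL (fun z : Fin 4 × Fin 4 => (Matrix.of ![![0, 0, 0, 0],
          ![0, r (0, 0), r (0, 1), r (0, 2)], ![0, r (1, 0), r (1, 1), r (1, 2)], ![ω, 0, 0, 0]])
          z.1 z.2)) =
      bL (fun z : Fin 4 × Fin 4 => (Matrix.of ![![0, 0, 0, 0],
          ![0, r' (0, 0), r' (0, 1), r' (0, 2)], ![0, r' (1, 0), r' (1, 1), r' (1, 2)],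
          ![ω', 0, 0, 0]]) z.1 z.2) := by
  classical
  -- the direction `a`, in the kernel, affine
  set a : Fin 4 × Fin 4 → k := fun z =>
    (Matrix.of ![![0, 1, 1, 1], ![0, 0, 0, 0], ![0, 0, 0, 0], ![0, 0, 0, 0]]) z.1 z.2 with ha
  have ha_ker : ∀ t : k, bL (t • a) = 0 := fun t =>
    (hker _).2 fun z hz => cross_a_off_row t z.1 z.2 fun h => hz (Or.inl h)
  have haff : ∀ (t : k) (z : Fin 4 × Fin 4 → k), ∃ e₀ e₁ : k, ∀ s : k,
      MvPolynomial.eval (z + s • (t • a)) (perPoly (Fin 4) k) = e₀ + s * e₁ := fun t z =>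
    affine_of_row k 0 (t • a) (fun i j hi => cross_a_off_row t i j hi) z
  -- the embedding of `X₀` and `B₁₂`
  let embX : (k × (Fin 2 × Fin 3 → k)) →ₗ[k] (Fin 4 × Fin 4 → k) :=
    { toFun := fun x z => (Matrix.of ![![0, 0, 0, 0], ![0, x.2 (0, 0), x.2 (0, 1), x.2 (0, 2)],
        ![0, x.2 (1, 0), x.2 (1, 1), x.2 (1, 2)], ![x.1, 0, 0, 0]]) z.1 z.2
      map_add' := fun x y => by
        funext z; obtain ⟨i, j⟩ := z
        fin_cases i <;> fin_cases j <;> simp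
      map_smul' := fun c x => by
        funext z; obtain ⟨i, j⟩ := z
        fin_cases i <;> fin_cases j <;> simp }
  have hembX : ∀ (ω₁ : k) (r₁ : Fin 2 × Fin 3 → k), embX (ω₁, r₁) = fun z : Fin 4 × Fin 4 =>
      (Matrix.of ![![0, 0, 0, 0], ![0, r₁ (0, 0), r₁ (0, 1), r₁ (0, 2)],
        ![0, r₁ (1, 0), r₁ (1, 1), r₁ (1, 2)], ![ω₁, 0, 0, 0]]) z.1 z.2 := fun _ _ => rfl
  set B₁₂ := LinearMap.range (bL ∘ₗ embX) with hB₁₂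
  have hB₁₂_le : finrank k B₁₂ ≤ 7 := by
    have h := LinearMap.finrank_range_le (bL ∘ₗ embX)
    have h7 : finrank k (k × (Fin 2 × Fin 3 → k)) = 7 := by
      rw [Module.finrank_prod]; simp
    rwa [h7] at h
  -- the operators `N = C(a) D⁻¹` and `T_t = (D + C(t a)) D⁻¹ = 1 + t N`
  set N := (CL a * D⁻¹).mulVecLin with hNdef
  have hNapp : ∀ y, N y = CL a *ᵥ (D⁻¹ *ᵥ y) := fun y => by
    rw [hNdef, Matrix.mulVecLin_apply, Matrix.mulVec_mulVec]
  have hT : ∀ (t : k) (y : ι' → k),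
      ((D + CL (t • a)) * D⁻¹).mulVecLin y = y + t • N y := by
    intro t y
    rw [Matrix.mulVecLin_apply, map_smul, Matrix.add_mul, Matrix.mul_nonsing_inv _ hD,
      Matrix.smul_mul, Matrix.add_mulVec, Matrix.one_mulVec, Matrix.smul_mulVec, hNapp,
      Matrix.mulVec_mulVec]
  set B := LinearMap.range bL with hBdef
  set K := (B ⊓ B.comap N : Submodule k (ι' → k)) with hKdef
  -- `M_t = B ⊓ T_t B = T_t K`
  have hM : ∀ t : k, t ≠ 0 →
      (B ⊓ B.map ((D + CL (t • a)) * D⁻¹).mulVecLin : Submodule k (ι' → k)) =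
        K.map ((D + CL (t • a)) * D⁻¹).mulVecLin := by
    intro t ht
    ext y
    rw [Submodule.mem_inf, Submodule.mem_map, Submodule.mem_map]
    constructor
    · rintro ⟨hyB, y', hy'B, rfl⟩
      refine ⟨y', Submodule.mem_inf.2 ⟨hy'B, ?_⟩, rfl⟩
      show N y' ∈ B
      have h1 : t • N y' ∈ B := by
        have := B.sub_mem hyB hy'B
        rwa [hT, add_sub_cancel_left] at this
      have := B.smul_mem t⁻¹ h1
      rwa [smul_smul, inv_mul_cancel₀ ht, one_smul] at this
    · rintro ⟨y', hy'K, rfl⟩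
      obtain ⟨hy'B, hy'N⟩ := Submodule.mem_inf.1 hy'K
      have hy'N' : N y' ∈ B := hy'N
      refine ⟨?_, y', hy'B, rfl⟩
      rw [hT]
      exact B.add_mem hy'B (B.smul_mem t hy'N')
  have hTinj : ∀ t : k, Function.Injective ((D + CL (t • a)) * D⁻¹).mulVecLin := by
    intro t
    apply Matrix.mulVec_injective_iff_isUnit.2
    rw [Matrix.isUnit_iff_isUnit_det, Matrix.det_mul]
    exact ((hN _ (ha_ker t)).1).mul (Matrix.isUnit_nonsing_inv_det_iff.2 hD)
  -- `dim K ≥ 7`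
  have hK7 : 7 ≤ finrank k K := by
    have h := four_mul_finrank_le_of_affine hD hDs bL CL hCs hκ hN ((1 : k) • a) (ha_ker 1)
      (haff 1)
    rw [← hBdef, hM 1 one_ne_zero,
      (Submodule.equivMapOfInjective _ (hTinj 1) K).finrank_eq.symm] at h
    omega
  -- the projection onto the complement coordinates
  let π : (Fin 4 × Fin 4 → k) →ₗ[k] (Fin 4 × Fin 4 → k) :=
    { toFun := fun x z => if z.1 = 0 ∨ z = (1, 0) ∨ z = (2, 0) then 0 else x z
      map_add' := fun x y => by
        funext z; simp only [Pi.add_apply]; split_ifs <;> simp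
      map_smul' := fun c x => by
        funext z; simp only [Pi.smul_apply, smul_eq_mul, RingHom.id_apply]; split_ifs <;> simp }
  have hπ : ∀ x z, π x z = if z.1 = 0 ∨ z = (1, 0) ∨ z = (2, 0) then 0 else x z := fun _ _ => rfl
  have hπb : ∀ x, bL (π x) = bL x := by
    intro x
    have h : bL (π x - x) = 0 := (hker _).2 fun z hz => by
      rw [Pi.sub_apply, hπ, if_neg hz, sub_self]
    rwa [map_sub, sub_eq_zero] at h
  have hπX : ∀ x, ∀ z : Fin 4 × Fin 4, (z.1 = 0 ∨ z = (1, 0) ∨ z = (2, 0)) → π x z = 0 :=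
    fun x z hz => by rw [hπ, if_pos hz]
  -- MAIN STEP: `M_t ≤ B₁₂` for `t ≠ 0`
  have hMle : ∀ t : k, t ≠ 0 →
      K.map ((D + CL (t • a)) * D⁻¹).mulVecLin ≤ B₁₂ := by
    intro t ht
    set Tt := ((D + CL (t • a)) * D⁻¹).mulVecLin with hTt
    set Mt := K.map Tt with hMt
    set St := (Submodule.comap bL Mt).map π with hSt
    -- the forms `C₁, C₂` vanish on `St`
    have hC : ∀ x ∈ St, ∀ i : Fin 4, (i = 1 ∨ i = 2) →
        (fun l : Fin 3 => x (3, l.succ)) ⬝ᵥ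
          (Matrix.of ![![(0 : k), 1, 1], ![1, 0, 1], ![1, 1, 0]]) *ᵥ
            (fun j : Fin 3 => x (i, j.succ)) = 0 := by
      rintro _ ⟨x₀, hx₀, rfl⟩ i hi
      have hx₀' : bL x₀ ∈ (B ⊓ B.map Tt : Submodule k (ι' → k)) := by
        rw [hTt, hM t ht]; exact hx₀
      obtain ⟨-, hx₀''⟩ := Submodule.mem_inf.1 hx₀'
      obtain ⟨_, ⟨z₀, rfl⟩, hyz⟩ := Submodule.mem_map.1 hx₀''
      have hx : (D + CL (t • a))⁻¹ *ᵥ bL (π x₀) = D⁻¹ *ᵥ bL z₀ := by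
        rw [hπb, ← hyz, hTt, Matrix.mulVecLin_apply, Matrix.mulVec_mulVec, ← Matrix.mul_assoc,
          Matrix.nonsing_inv_mul _ (hN _ (ha_ker t)).1, Matrix.one_mul]
      rw [← cross_form_eq]
      exact cross_forms_vanish hDs bL CL hCs hκ hii hN hker t ht (π x₀) z₀ hx i hi
    -- the count
    have hrows := rows_three_eq_zero_of_isotropic
      (Matrix.of ![![(0 : k), 1, 1], ![1, 0, 1], ![1, 1, 0]])
      (by rw [Matrix.det_fin_three]; simp) St
      (by rintro _ ⟨x₀, -, rfl⟩ z hz; exact hπX x₀ z hz)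
      (fun x hx x' hx' => by
        rw [← cross_form_polar, hC x hx 2 (Or.inr rfl), hC x' hx' 2 (Or.inr rfl),
          hC (x + x') (St.add_mem hx hx') 2 (Or.inr rfl), sub_zero, sub_zero])
      (fun x hx x' hx' => by
        rw [← cross_form_polar, hC x hx 1 (Or.inl rfl), hC x' hx' 1 (Or.inl rfl),
          hC (x + x') (St.add_mem hx hx') 1 (Or.inl rfl), sub_zero, sub_zero])
      (by
        have hMtle : Mt ≤ LinearMap.range bL := by
          rw [hMt, ← hM t ht]; exact inf_le_left
        have h1 : St.map bL = Mt := by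
          rw [hSt, ← Submodule.map_comp, show bL ∘ₗ π = bL from LinearMap.ext hπb,
            Submodule.map_comap_eq, inf_eq_right.2 hMtle]
        have h2 := Submodule.finrank_map_le bL St
        rw [h1] at h2
        have h3 : finrank k Mt = finrank k K :=
          (Submodule.equivMapOfInjective _ (hTinj t) K).finrank_eq.symm
        omega)
    -- hence every element of `M_t` is a kernel row of `X₀`
    intro y hy
    have hyB : y ∈ LinearMap.range bL := by
      have : y ∈ (B ⊓ B.map Tt : Submodule k (ι' → k)) := by rw [hM t ht]; exact hy
      exact (Submodule.mem_inf.1 this).1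
    obtain ⟨x₀, rfl⟩ := hyB
    have hx₀ : π x₀ ∈ St := ⟨x₀, hy, rfl⟩
    have h3 := hrows (π x₀) hx₀
    refine ⟨((π x₀) (3, 0), fun p : Fin 2 × Fin 3 => (π x₀) (p.1.castSucc.succ, p.2.succ)), ?_⟩
    rw [LinearMap.comp_apply, ← hπb x₀, hembX]
    congr 1
    refine ((eq_cross_of_rows_three (π x₀) (hπX x₀) h3).trans ?_).symm
    rfl
  -- `K ≤ B₁₂`, `N K ≤ B₁₂`, hence `K = B₁₂` and `N B₁₂ ≤ B₁₂`
  have hK_le : ∀ y ∈ K, y ∈ B₁₂ ∧ N y ∈ B₁₂ := by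
    intro y hy
    have h1 : y + (1 : k) • N y ∈ B₁₂ := hMle 1 one_ne_zero ⟨y, hy, hT 1 y⟩
    have h2 : y + (2 : k) • N y ∈ B₁₂ := hMle 2 two_ne_zero ⟨y, hy, hT 2 y⟩
    rw [one_smul] at h1
    rw [two_smul] at h2
    have hNy : N y ∈ B₁₂ := by
      have := B₁₂.sub_mem h2 h1
      rwa [show y + (N y + N y) - (y + N y) = N y by abel] at this
    refine ⟨?_, hNy⟩
    have := B₁₂.sub_mem h1 hNy
    rwa [add_sub_cancel_right] at this
  have hKB : K = B₁₂ :=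
    Submodule.eq_of_le_of_finrank_le (fun y hy => (hK_le y hy).1) (hB₁₂_le.trans hK7)
  have hy : bL (embX (ω, r)) ∈ B₁₂ := ⟨(ω, r), rfl⟩
  rw [← hKB] at hy
  obtain ⟨⟨ω', r'⟩, h⟩ := (hK_le _ hy).2
  refine ⟨ω', r', ?_⟩
  rw [← hembX ω r, ← hembX ω' r', ← hNapp]
  exact h.symm

end Summit.ValiantsHypothesis.ValiantsHypothesis.Theorems.SymPencilPerFourCrossSixFront

end
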